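import Summits.Schanuel.Schanuel.Theses.RoyCriterion

/-!
# Crux-plan `torsion-companion-period-sector` for crux `stmt-Schanuel-0463`
(`Summit.Schanuel.Schanuel.Theses.RoyCriterion.RoyThesisTyped = ∀ n, RoyCriterion n`)

**Verdict of this crux-plan seat: NO CONCLUDING SKELETON** (see `Lines/torsion-companion-period-sector.md`).
This file is NOT a registered skeleton: it contains no `RoyThesisTyped_of` and no `stub_*`.
It records, kernel-checked, everything the idea's lever reaches on this crux, so that the
salvage (a Literature named fact + one support item) can be filed without redoing the work.

* §0 `crux_iff_summit` — the crux is the summit `Schanuel` rank by rank (from the tree theorem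
  `Roy2001_iff_holds`); hence any composition `stub₁ → … → stub_k → RoyThesisTyped` whose stubs are
  not themselves a proof plan for ALL of Schanuel must contain a stub "RoyCriterion off the period
  sector" = the summit minus a countable set of rank-2 tuples — a COSTUME stub by definition.
* §1 `Tubbs1990_thm4_periods` — NAMED-FACT CANDIDATE (a `Prop`, nothing asserted): R. Tubbs,
  *Algebraic groups and small transcendence degree II*, J. Number Theory 35 (1990) 109–127,
  Theorem 4 (p.112) with the remark p.114 ("for any λ ≠ 0 at least two of g₂, g₃, ω₁, ω₂, λ,
  e^{λω₁}, e^{λω₂} are algebraically independent"; ω₁, ω₂ a basis of the period lattice, p.112)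
  = G. V. Chudnovsky, *Contributions* (AMS Surveys 19, 1984), Ch. 7, Thm 4.1 (i), p.318 (there with
  half-periods; same field). Both read on the page this session.
* §2 folklore field lemmas (`trdeg_mono`, absolute/relative "algebraic adjunction does not change
  trdeg"), copied from `Literature.Barriers.Schanuel.*` to keep the import cone at the route file.
* §3 the PERIOD SECTOR `InPeriodSector y` (y = c • (ω₁, ω₂), c ≠ 0 algebraic, g₂ g₃ algebraic —
  triage r1-3's free enlargement of the card's sector), its closure under `y ↦ d • y`, its
  ℚ-linear independence, and **Schanuel(2) on the sector** from the fact (`two_le_trdeg_of_inPeriodSector`).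
* §4 **the rank-2 rung of the crux on the sector** (`royCriterion_two_on_sector`): Roy's
  Conjecture 2 at every sector point, from the fact + `royThm1BtoA_holds` (Roy 2001 Prop. 3, tree).
* §5 the support-item candidate signatures: `schanuelTwo_on_periodLattices` (SchanuelTwo's format,
  x = ![ω₁, ω₂]) and the arbitrary-lattice form with g₂, g₃ algebraic over ℚ(ω₁, ω₂, e^{ω₁}, e^{ω₂})
  (triage r1-1's sharpening), plus `periodLattices_of_schanuelTwo` (the item sits BELOW crux
  SchanuelTwo = stmt-Schanuel-0069).

Sorries: none. The fact enters only as a hypothesis `(h : Tubbs1990_thm4_periods)`.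
-/

noncomputable section

set_option linter.dupNamespace false

open Complex IntermediateField

namespace Summit.Schanuel.Schanuel.Cruxes.RoyThesisTyped.TorsionCompanionPeriodSector

open Literature.NumberTheory.Transcendental
open Summit.Schanuel.Schanuel.Theses.RoyCriterion (RoyThesisTyped SchanuelTwo)

/-! ### §0 The crux is the summit (why no honest concluding skeleton exists for a sector idea) -/

/-- `RoyThesisTyped ↔ Schanuel`: Roy's equivalence rank by rank (`Roy2001_iff_holds`, tree,
sorry-free) and `Schanuel = ∀ l, SchanuelRank l` definitionally. [folklore] -/
theorem crux_iff_summit : RoyThesisTyped ↔ _root_.Schanuel :=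
  ⟨fun hX n => (Roy2001_iff_holds n).mp (hX n), fun hS n => (Roy2001_iff_holds n).mpr (hS n)⟩

/-! ### §1 The named-fact candidate -/

/-- NAMED-FACT CANDIDATE — **Tubbs 1990, Theorem 4 (periods form, remark p.114) = Chudnovsky 1984,
Ch. 7, Thm 4.1 (i)**: for ANY lattice basis `(ω₁, ω₂)` (no hypothesis on `g₂, g₃`) and any `c ≠ 0`,
`trdeg_ℚ ℚ(g₂, g₃, ω₁, ω₂, c, e^{cω₁}, e^{cω₂}) ≥ 2` ("at least two of the seven numbers are
algebraically independent" ⟺ the generated field has `trdeg ≥ 2`). Printed proof: auxiliary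
function `F(z) = P(z, ℘(z), e^{cz})` on `𝔾ₐ × 𝔾ₘ × E`, zeros at the torsion orbit `ℤω₁ + ℤω₂`,
Philippon's zero estimate + Gelfond's criterion (Tubbs §5, pp.124–127). To be vendored in
`Literature/NumberTheory/Transcendental/` (cite item filed by this seat); users take
`(h : Tubbs1990_thm4_periods)`. -/
def Tubbs1990_thm4_periods : Prop :=
  ∀ (L : PeriodPair) (c : ℂ), c ≠ 0 →
    (2 : Cardinal) ≤ Algebra.trdeg ℚ
      ↥(adjoin ℚ ({L.g₂, L.g₃, L.ω₁, L.ω₂, c, cexp (c * L.ω₁), cexp (c * L.ω₂)} : Set ℂ))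

/-! ### §2 Field-theoretic helpers (folklore; copies of `Literature.Barriers.Schanuel` lemmas) -/

/-- Monotonicity of `trdeg` along an inclusion of intermediate fields. [folklore] -/
theorem trdeg_mono {L L' : IntermediateField ℚ ℂ} (h : L ≤ L') :
    Algebra.trdeg ℚ L ≤ Algebra.trdeg ℚ L' :=
  trdeg_le_of_injective (inclusion h) (inclusion_injective h)

/-- Adjoining elements algebraic over `K(S)` does not change `trdeg_K` (verbatim
`Literature.Barriers.Schanuel.trdeg_adjoin_union_eq_of_isAlgebraic_adjoin`). [folklore] -/
theorem trdeg_adjoin_union_eq_of_isAlgebraic_adjoin {K E : Type*} [Field K] [Field E]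
    [Algebra K E] (S T : Set E) (hT : ∀ x ∈ T, IsAlgebraic (adjoin K S) x) :
    Algebra.trdeg K (adjoin K (S ∪ T)) = Algebra.trdeg K (adjoin K S) := by
  haveI : FaithfulSMul (adjoin K S) (adjoin (adjoin K S) T) :=
    (faithfulSMul_iff_algebraMap_injective (adjoin K S) (adjoin (adjoin K S) T)).mpr
      (algebraMap (adjoin K S) (adjoin (adjoin K S) T)).injective
  have htower := trdeg_add_eq K (adjoin K S) (A := adjoin (adjoin K S) T)
  have heq : Algebra.trdeg K (adjoin (adjoin K S) T) = Algebra.trdeg K (adjoin K (S ∪ T)) := by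
    rw [← (equivOfEq (adjoin_adjoin_left K S T)).trdeg_eq]
    rfl
  haveI : Algebra.IsAlgebraic (adjoin K S) (adjoin (adjoin K S) T) :=
    IntermediateField.isAlgebraic_adjoin fun x hx => (hT x hx).isIntegral
  have h0 : Algebra.trdeg (adjoin K S) (adjoin (adjoin K S) T) = 0 := trdeg_eq_zero
  rw [h0, add_zero, heq] at htower
  exact htower.symm

/-- Adjoining elements algebraic over `K` does not change `trdeg_K` (cf.
`Literature.Barriers.Schanuel.trdeg_adjoin_union_eq_of_isAlgebraic`). [folklore] -/
theorem trdeg_adjoin_union_eq_of_isAlgebraic {K E : Type*} [Field K] [Field E] [Algebra K E]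
    (S T : Set E) (hT : ∀ x ∈ T, IsAlgebraic K x) :
    Algebra.trdeg K (adjoin K (S ∪ T)) = Algebra.trdeg K (adjoin K S) :=
  trdeg_adjoin_union_eq_of_isAlgebraic_adjoin S T fun x hx => (hT x hx).tower_top _

/-! ### §3 The period sector and Schanuel(2) on it -/

/-- The rank-2 PERIOD SECTOR: `y = c • (ω₁, ω₂)` for a basis `(ω₁, ω₂)` of a lattice with
ALGEBRAIC invariants `g₂, g₃` (a Weierstrass model over `ℚ̄`) and an algebraic `c ≠ 0`
(card: `c = 1`; triage r1-3: the enlargement to `c ∈ ℚ̄ˣ` is free, take `λ = c` in the fact).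
Example: `y = (ϖ, iϖ)`, `ϖ = Γ(1/4)²/(2√(2π))` (lemniscate, `g₃ = 0`). -/
def InPeriodSector (y : Fin 2 → ℂ) : Prop :=
  ∃ (L : PeriodPair) (c : ℂ), c ≠ 0 ∧ IsAlgebraic ℚ c ∧ IsAlgebraic ℚ L.g₂ ∧ IsAlgebraic ℚ L.g₃ ∧
    y = ![c * L.ω₁, c * L.ω₂]

/-- The sector is closed under `y ↦ d • y`, `d ≥ 1` (same lattice, `c ↦ d c`) — the closure
`royCriterion_two_on_sector` needs (Roy's Prop. 3 moves `y` to `d • y`). [folklore] -/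
theorem inPeriodSector_natMul {y : Fin 2 → ℂ} (hy : InPeriodSector y) {d : ℕ} (hd : 0 < d) :
    InPeriodSector (fun j => (d : ℂ) * y j) := by
  obtain ⟨L, c, hc, hca, h₂, h₃, rfl⟩ := hy
  refine ⟨L, (d : ℂ) * c, mul_ne_zero (by exact_mod_cast hd.ne') hc,
    (isAlgebraic_nat d).mul hca, h₂, h₃, ?_⟩
  funext j
  fin_cases j <;> simp [mul_assoc]

/-- A lattice basis scaled by `c ≠ 0` is `ℚ`-linearly independent (an `ℝ`-basis of `ℂ`;
restriction of scalars `ℚ ⊆ ℝ`, then the injective `ℚ`-linear map `z ↦ c z`). [folklore] -/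
theorem linearIndependent_smul_periods (L : PeriodPair) {c : ℂ} (hc : c ≠ 0) :
    LinearIndependent ℚ ![c * L.ω₁, c * L.ω₂] := by
  have hℝ : LinearIndependent ℝ ![L.ω₁, L.ω₂] := L.indep
  have hℚ : LinearIndependent ℚ ![L.ω₁, L.ω₂] := hℝ.restrict_scalars' ℚ
  have hmul : LinearIndependent ℚ ((LinearMap.mulLeft ℚ c) ∘ ![L.ω₁, L.ω₂]) :=
    hℚ.map' (LinearMap.mulLeft ℚ c) (by
      rw [LinearMap.ker_eq_bot]
      exact mul_right_injective₀ hc)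
  convert hmul using 1
  funext j
  fin_cases j <;> simp

/-- A sector tuple is `ℚ`-linearly independent, so the sector lies inside the hypothesis domain
of `SchanuelTwo` / `RoyCriterion 2`. [folklore] -/
theorem linearIndependent_of_inPeriodSector {y : Fin 2 → ℂ} (hy : InPeriodSector y) :
    LinearIndependent ℚ y := by
  obtain ⟨L, c, hc, -, -, -, rfl⟩ := hy
  exact linearIndependent_smul_periods L hc

/-- **Schanuel's conjecture in rank 2 holds on the period sector**, modulo the printed fact:
with `λ = c`, `ℚ(y, e^y)(g₂, g₃, c) ⊇ ℚ(g₂, g₃, ω₁, ω₂, c, e^{cω₁}, e^{cω₂})` (`ωᵢ = c⁻¹ · yᵢ`),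
and adjoining the algebraic `g₂, g₃, c` does not change `trdeg`. [folklore] -/
theorem two_le_trdeg_of_inPeriodSector (h : Tubbs1990_thm4_periods) {y : Fin 2 → ℂ}
    (hy : InPeriodSector y) :
    (2 : Cardinal) ≤ Algebra.trdeg ℚ ↥(adjoin ℚ (Set.range y ∪ Set.range (cexp ∘ y))) := by
  obtain ⟨L, c, hc, hca, h₂, h₃, rfl⟩ := hy
  set S : Set ℂ := Set.range ![c * L.ω₁, c * L.ω₂] ∪ Set.range (cexp ∘ ![c * L.ω₁, c * L.ω₂])
    with hS
  set T : Set ℂ := {L.g₂, L.g₃, c} with hT_def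
  have hT : ∀ x ∈ T, IsAlgebraic ℚ x := by
    intro x hx
    simp only [hT_def, Set.mem_insert_iff, Set.mem_singleton_iff] at hx
    rcases hx with rfl | rfl | rfl
    exacts [h₂, h₃, hca]
  have hsub : S ∪ T ⊆ (adjoin ℚ (S ∪ T) : Set ℂ) := subset_adjoin ℚ _
  have hg₂ : L.g₂ ∈ adjoin ℚ (S ∪ T) := hsub (Or.inr (by simp [hT_def]))
  have hg₃ : L.g₃ ∈ adjoin ℚ (S ∪ T) := hsub (Or.inr (by simp [hT_def]))
  have hcm : c ∈ adjoin ℚ (S ∪ T) := hsub (Or.inr (by simp [hT_def]))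
  have hy0 : c * L.ω₁ ∈ adjoin ℚ (S ∪ T) := hsub (Or.inl (Or.inl ⟨0, by simp⟩))
  have hy1 : c * L.ω₂ ∈ adjoin ℚ (S ∪ T) := hsub (Or.inl (Or.inl ⟨1, by simp⟩))
  have he0 : cexp (c * L.ω₁) ∈ adjoin ℚ (S ∪ T) := hsub (Or.inl (Or.inr ⟨0, by simp⟩))
  have he1 : cexp (c * L.ω₂) ∈ adjoin ℚ (S ∪ T) := hsub (Or.inl (Or.inr ⟨1, by simp⟩))
  have hω₁ : L.ω₁ ∈ adjoin ℚ (S ∪ T) := by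
    have : L.ω₁ = c⁻¹ * (c * L.ω₁) := by field_simp
    rw [this]
    exact mul_mem (inv_mem hcm) hy0
  have hω₂ : L.ω₂ ∈ adjoin ℚ (S ∪ T) := by
    have : L.ω₂ = c⁻¹ * (c * L.ω₂) := by field_simp
    rw [this]
    exact mul_mem (inv_mem hcm) hy1
  have hF : adjoin ℚ ({L.g₂, L.g₃, L.ω₁, L.ω₂, c, cexp (c * L.ω₁), cexp (c * L.ω₂)} : Set ℂ) ≤
      adjoin ℚ (S ∪ T) := by
    refine adjoin_le_iff.mpr ?_
    intro x hx
    simp only [Set.mem_insert_iff, Set.mem_singleton_iff] at hx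
    rcases hx with rfl | rfl | rfl | rfl | rfl | rfl | rfl
    exacts [hg₂, hg₃, hω₁, hω₂, hcm, he0, he1]
  calc (2 : Cardinal)
      ≤ Algebra.trdeg ℚ
          ↥(adjoin ℚ ({L.g₂, L.g₃, L.ω₁, L.ω₂, c, cexp (c * L.ω₁), cexp (c * L.ω₂)} : Set ℂ)) :=
        h L c hc
    _ ≤ Algebra.trdeg ℚ ↥(adjoin ℚ (S ∪ T)) := trdeg_mono hF
    _ = Algebra.trdeg ℚ ↥(adjoin ℚ S) := trdeg_adjoin_union_eq_of_isAlgebraic S T hT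

/-! ### §4 The rank-2 rung of the crux on the sector -/

/-- **Roy's Conjecture 2 (the crux, rank 2) at every point of the period sector**, modulo the
fact: Roy 2001 Thm 1 `(b) ⇒ (a)` (`royThm1BtoA_holds`, from Prop. 3, tree) gives `d ≥ 1` with
`α_j^d = e^{d y_j}`; `d • y` is again in the sector, so `trdeg ℚ(d•y, e^{d•y}) ≥ 2` by §3, and
`ℚ(d•y, α^d) ⊆ ℚ(y, α)` — verbatim the tree proof `royCriterion_of_schanuelRank` with Schanuel(2)
replaced by the sector theorem. This is the WHOLE reach of the lever on `RoyThesisTyped`.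
[folklore] -/
theorem royCriterion_two_on_sector (h : Tubbs1990_thm4_periods) {y : Fin 2 → ℂ}
    (hy : InPeriodSector y) (α : Fin 2 → ℂ) (hα : ∀ j, α j ≠ 0) (s₀ s₁ t₀ t₁ u : ℝ)
    (hadm : RoyAdmissible s₀ s₁ t₀ t₁ u) (hhyp : RoyHypothesis y α s₀ s₁ t₀ t₁ u) :
    (2 : Cardinal) ≤ Algebra.trdeg ℚ ↥(adjoin ℚ (Set.range y ∪ Set.range α)) := by
  have hd : ∀ j, RoyConditionA (y j) (α j) := fun j =>
    royThm1BtoA_holds (y j) (α j) (hα j) s₀ s₁ t₀ t₁ u hadm (royConditionB_of_royHypothesis hhyp j)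
  choose d hd1 hd2 using hd
  set D : ℕ := ∏ j, d j with hD
  have hD0 : 0 < D := Finset.prod_pos fun j _ => hd1 j
  have hαD : ∀ j, α j ^ D = cexp (D * y j) := by
    intro j
    obtain ⟨e, he⟩ : d j ∣ D := Finset.dvd_prod_of_mem _ (Finset.mem_univ j)
    rw [he, pow_mul, hd2 j, ← Complex.exp_nat_mul]
    push_cast; ring_nf
  set y' : Fin 2 → ℂ := fun j => (D : ℂ) * y j with hy'_def
  have hy' : InPeriodSector y' := inPeriodSector_natMul hy hD0
  have hle : adjoin ℚ (Set.range y' ∪ Set.range (cexp ∘ y')) ≤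
      adjoin ℚ (Set.range y ∪ Set.range α) := by
    refine adjoin_le_iff.mpr ?_
    rintro x (⟨j, rfl⟩ | ⟨j, rfl⟩)
    · exact mul_mem (IntermediateField.natCast_mem _ D) (subset_adjoin _ _ (Or.inl ⟨j, rfl⟩))
    · change cexp ((D : ℂ) * y j) ∈ _
      rw [← hαD j]
      exact pow_mem (subset_adjoin ℚ (Set.range y ∪ Set.range α) (Or.inr ⟨j, rfl⟩)) D
  calc (2 : Cardinal)
      ≤ Algebra.trdeg ℚ ↥(adjoin ℚ (Set.range y' ∪ Set.range (cexp ∘ y'))) :=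
        two_le_trdeg_of_inPeriodSector h hy'
    _ ≤ Algebra.trdeg ℚ ↥(adjoin ℚ (Set.range y ∪ Set.range α)) := trdeg_mono hle

/-! ### §5 Support-item candidates (signatures checked here; to be filed on the route) -/

/-- SUPPORT-ITEM CANDIDATE `SchanuelTwoOnPeriodLattices` in `SchanuelTwo`'s own format
(`x = ![ω₁, ω₂]`): for every lattice basis with algebraic invariants,
`trdeg ℚ(ω₁, ω₂, e^{ω₁}, e^{ω₂}) ≥ 2` — PROVED modulo the fact (`c = 1`). These are the first
unconditional rank-2 Schanuel instances in the tree beyond Lindemann–Weierstrass /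
Hermite–Lindemann (e.g. `(ϖ, iϖ)`), disjoint from the flagship open instances `(1, πi)`,
`(1, e)`, `(log 2, √2 log 2)`, `(πi, log 2)`. [folklore] -/
theorem schanuelTwo_on_periodLattices (h : Tubbs1990_thm4_periods) (L : PeriodPair)
    (h₂ : IsAlgebraic ℚ L.g₂) (h₃ : IsAlgebraic ℚ L.g₃) :
    (2 : Cardinal) ≤ Algebra.trdeg ℚ
      ↥(adjoin ℚ (Set.range ![L.ω₁, L.ω₂] ∪ Set.range (cexp ∘ ![L.ω₁, L.ω₂]))) := by
  have hy : InPeriodSector ![L.ω₁, L.ω₂] :=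
    ⟨L, 1, one_ne_zero, isAlgebraic_one, h₂, h₃, by simp⟩
  exact two_le_trdeg_of_inPeriodSector h hy

/-- The candidate sits BELOW the crux `SchanuelTwo` (stmt-Schanuel-0069): it is its restriction
to period-lattice bases. [folklore] -/
theorem periodLattices_of_schanuelTwo (hS : SchanuelTwo) (L : PeriodPair) :
    (2 : Cardinal) ≤ Algebra.trdeg ℚ
      ↥(adjoin ℚ (Set.range ![L.ω₁, L.ω₂] ∪ Set.range (cexp ∘ ![L.ω₁, L.ω₂]))) := by
  have hli : LinearIndependent ℚ ![L.ω₁, L.ω₂] := by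
    simpa using linearIndependent_smul_periods L one_ne_zero
  exact hS _ hli

/-- SUPPORT-ITEM CANDIDATE, arbitrary-lattice form (triage r1-1's sharpening, `c = 1`): for ANY
lattice basis, if `g₂, g₃` are algebraic over `K = ℚ(ω₁, ω₂, e^{ω₁}, e^{ω₂})` then `trdeg_ℚ K ≥ 2`
(the fact's field with `λ = 1` lies in `K(g₂, g₃)`, a `trdeg`-neutral extension of `K`). [folklore] -/
theorem two_le_trdeg_periods_exp_of_isAlgebraic_adjoin (h : Tubbs1990_thm4_periods)
    (L : PeriodPair)
    (h₂ : IsAlgebraic (adjoin ℚ ({L.ω₁, L.ω₂, cexp L.ω₁, cexp L.ω₂} : Set ℂ)) L.g₂)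
    (h₃ : IsAlgebraic (adjoin ℚ ({L.ω₁, L.ω₂, cexp L.ω₁, cexp L.ω₂} : Set ℂ)) L.g₃) :
    (2 : Cardinal) ≤ Algebra.trdeg ℚ ↥(adjoin ℚ ({L.ω₁, L.ω₂, cexp L.ω₁, cexp L.ω₂} : Set ℂ)) := by
  set S : Set ℂ := {L.ω₁, L.ω₂, cexp L.ω₁, cexp L.ω₂} with hS_def
  set T : Set ℂ := {L.g₂, L.g₃} with hT_def
  have hT : ∀ x ∈ T, IsAlgebraic (adjoin ℚ S) x := by
    intro x hx
    simp only [hT_def, Set.mem_insert_iff, Set.mem_singleton_iff] at hx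
    rcases hx with rfl | rfl
    exacts [h₂, h₃]
  have hsub : S ∪ T ⊆ (adjoin ℚ (S ∪ T) : Set ℂ) := subset_adjoin ℚ _
  have hg₂ : L.g₂ ∈ adjoin ℚ (S ∪ T) := hsub (Or.inr (by simp [hT_def]))
  have hg₃ : L.g₃ ∈ adjoin ℚ (S ∪ T) := hsub (Or.inr (by simp [hT_def]))
  have hω₁ : L.ω₁ ∈ adjoin ℚ (S ∪ T) := hsub (Or.inl (by simp [hS_def]))
  have hω₂ : L.ω₂ ∈ adjoin ℚ (S ∪ T) := hsub (Or.inl (by simp [hS_def]))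
  have he₁ : cexp L.ω₁ ∈ adjoin ℚ (S ∪ T) := hsub (Or.inl (by simp [hS_def]))
  have he₂ : cexp L.ω₂ ∈ adjoin ℚ (S ∪ T) := hsub (Or.inl (by simp [hS_def]))
  have h1 : (1 : ℂ) ∈ adjoin ℚ (S ∪ T) := one_mem _
  have hF : adjoin ℚ ({L.g₂, L.g₃, L.ω₁, L.ω₂, (1 : ℂ), cexp (1 * L.ω₁), cexp (1 * L.ω₂)} : Set ℂ) ≤
      adjoin ℚ (S ∪ T) := by
    refine adjoin_le_iff.mpr ?_
    intro x hx
    simp only [one_mul, Set.mem_insert_iff, Set.mem_singleton_iff] at hx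
    rcases hx with rfl | rfl | rfl | rfl | rfl | rfl | rfl
    exacts [hg₂, hg₃, hω₁, hω₂, h1, he₁, he₂]
  calc (2 : Cardinal)
      ≤ Algebra.trdeg ℚ
          ↥(adjoin ℚ ({L.g₂, L.g₃, L.ω₁, L.ω₂, (1 : ℂ), cexp (1 * L.ω₁), cexp (1 * L.ω₂)} :
            Set ℂ)) := h L 1 one_ne_zero
    _ ≤ Algebra.trdeg ℚ ↥(adjoin ℚ (S ∪ T)) := trdeg_mono hF
    _ = Algebra.trdeg ℚ ↥(adjoin ℚ S) := trdeg_adjoin_union_eq_of_isAlgebraic_adjoin S T hT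

end Summit.Schanuel.Schanuel.Cruxes.RoyThesisTyped.TorsionCompanionPeriodSector

end
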